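import Mathlib
import Literature.MathematicalPhysics.QuantumFieldTheory.Balaban1983to89.Setup

/-!
# `Summit.QuantumFields.Balaban3D.Proofs.TorusBalls` — lane «pub-balaban3d» (Bałaban, CMP **102** (1985) 255–275, d = 3 lattice UV
# stability AS PRINTED), prover seat p2: BALL COUNTS on `Setup`'s discrete tori — the lattice input of the collar count
# `B10LargeFieldSum.ZvolCover` («|Z_j| ≤ Σ (c_g·R(g_i)M₁)³», (39) p. 266 / pp. 267–268) that the 4D cell leaves unmodelled
# (its DIVERGENCE D-b10.7: «the count of L^jη-lattice points in a ball is not modelled»)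

HONEST FRAMING (lane PLAN.md §0).  Nothing of [B10] = [Balaban1985UV3] is asserted; pure combinatorics of `ZMod n` and of the torus
`Site P j = Fin d → ZMod (sitesPerDir j)` with its `ℓ¹` distance `Site.tdist` (LQB `Setup`).
* `card_filter_val_le`, `card_zmod_near_le` — on `ZMod n`, at most `2(r + 1)` residues lie within torus distance `r` of a point;
* `card_torusBall_le` — on `Site P j`, at most `(2(r + 1))^d` sites lie within `tdist ≤ r` of a point.
-/

namespace Summit.QuantumFields.Balaban3D.Proofs.TorusBalls

open Literature.MathematicalPhysics.QuantumFieldTheory.Balaban1983to89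
open Finset

/-! ## §1 One coordinate: `ZMod n` -/

section OneDim

variable {n : ℕ} [NeZero n]

/-- At most `r + 1` residues have `val ≤ r` (`ZMod.val` is injective into `{0, …, r}`). [folklore] -/
theorem card_filter_val_le (r : ℕ) :
    ((Finset.univ : Finset (ZMod n)).filter (fun w => w.val ≤ r)).card ≤ r + 1 := by
  classical
  calc ((Finset.univ : Finset (ZMod n)).filter (fun w => w.val ≤ r)).card
      = (((Finset.univ : Finset (ZMod n)).filter (fun w => w.val ≤ r)).image ZMod.val).card :=
        (Finset.card_image_of_injective _ (ZMod.val_injective n)).symm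
    _ ≤ (Finset.range (r + 1)).card := by
        refine Finset.card_le_card fun m hm => ?_
        obtain ⟨w, hw, rfl⟩ := Finset.mem_image.mp hm
        exact Finset.mem_range.mpr (Nat.lt_succ_of_le (Finset.mem_filter.mp hw).2)
    _ = r + 1 := Finset.card_range _

/-- On `ZMod n`, at most `2(r + 1)` residues `z` lie within torus distance `r` of `a`:
`min((z − a).val, (a − z).val) ≤ r`. [folklore] -/
theorem card_zmod_near_le (a : ZMod n) (r : ℕ) :
    ((Finset.univ : Finset (ZMod n)).filter (fun z => min (z - a).val (a - z).val ≤ r)).card ≤ 2 * (r + 1) := by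
  classical
  -- split the `min`: `{z | (z − a).val ≤ r} ∪ {z | (a − z).val ≤ r}`
  have hsub : (Finset.univ : Finset (ZMod n)).filter (fun z => min (z - a).val (a - z).val ≤ r) ⊆
      (Finset.univ.filter fun z : ZMod n => (z - a).val ≤ r) ∪ (Finset.univ.filter fun z : ZMod n => (a - z).val ≤ r) := by
    intro z hz
    rw [Finset.mem_filter] at hz
    rw [Finset.mem_union, Finset.mem_filter, Finset.mem_filter]
    rcases min_le_iff.mp hz.2 with h | h
    · exact Or.inl ⟨Finset.mem_univ _, h⟩
    · exact Or.inr ⟨Finset.mem_univ _, h⟩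
  -- each piece is a translate (resp. reflected translate) of `{w | w.val ≤ r}`
  have h1 : (Finset.univ.filter fun z : ZMod n => (z - a).val ≤ r).card ≤ r + 1 := by
    have : (Finset.univ.filter fun z : ZMod n => (z - a).val ≤ r) =
        ((Finset.univ : Finset (ZMod n)).filter (fun w => w.val ≤ r)).image (fun w => w + a) := by
      ext z
      simp only [Finset.mem_filter, Finset.mem_univ, true_and, Finset.mem_image]
      constructor
      · intro hz; exact ⟨z - a, hz, sub_add_cancel z a⟩
      · rintro ⟨w, hw, rfl⟩; simpa using hw
    rw [this]
    exact Finset.card_image_le.trans (card_filter_val_le r)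
  have h2 : (Finset.univ.filter fun z : ZMod n => (a - z).val ≤ r).card ≤ r + 1 := by
    have : (Finset.univ.filter fun z : ZMod n => (a - z).val ≤ r) =
        ((Finset.univ : Finset (ZMod n)).filter (fun w => w.val ≤ r)).image (fun w => a - w) := by
      ext z
      simp only [Finset.mem_filter, Finset.mem_univ, true_and, Finset.mem_image]
      constructor
      · intro hz; exact ⟨a - z, hz, sub_sub_cancel a z⟩
      · rintro ⟨w, hw, rfl⟩; simpa using hw
    rw [this]
    exact Finset.card_image_le.trans (card_filter_val_le r)
  calc _ ≤ ((Finset.univ.filter fun z : ZMod n => (z - a).val ≤ r) ∪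
        (Finset.univ.filter fun z : ZMod n => (a - z).val ≤ r)).card := Finset.card_le_card hsub
    _ ≤ _ := Finset.card_union_le _ _
    _ ≤ (r + 1) + (r + 1) := add_le_add h1 h2
    _ = 2 * (r + 1) := by ring

end OneDim

/-! ## §2 The torus `Site P j` with its `ℓ¹` distance -/

section Torus

variable {P : Params} {j : ℕ}

/-- **Ball count on the discrete torus:** at most `(2(r + 1))^d` sites `y` of `T^{(j)}` have `tdist x y ≤ r` (`ℓ¹` torus distance
of `Setup.Site.tdist`): `tdist ≤ r` forces every coordinate distance `≤ r`, and the coordinate balls have `≤ 2(r + 1)` points. [folklore] -/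
theorem card_torusBall_le (x : Site P j) (r : ℕ) :
    ((Finset.univ : Finset (Site P j)).filter (fun y => Site.tdist x y ≤ r)).card ≤ (2 * (r + 1)) ^ P.d := by
  classical
  -- the ball sits inside the product of the coordinate balls
  have hsub : (Finset.univ : Finset (Site P j)).filter (fun y => Site.tdist x y ≤ r) ⊆
      Fintype.piFinset (fun μ : Fin P.d =>
        (Finset.univ : Finset (ZMod (P.sitesPerDir j))).filter (fun z => min (z - x μ).val (x μ - z).val ≤ r)) := by
    intro y hy
    rw [Finset.mem_filter] at hy
    refine Fintype.mem_piFinset.mpr fun μ => Finset.mem_filter.mpr ⟨Finset.mem_univ _, ?_⟩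
    have hle : min (x μ - y μ).val (y μ - x μ).val ≤ Site.tdist x y := by
      unfold Site.tdist
      exact Finset.single_le_sum (f := fun μ => min (x μ - y μ).val (y μ - x μ).val) (fun _ _ => Nat.zero_le _)
        (Finset.mem_univ μ)
    rw [min_comm]
    exact hle.trans hy.2
  calc _ ≤ (Fintype.piFinset (fun μ : Fin P.d =>
        (Finset.univ : Finset (ZMod (P.sitesPerDir j))).filter (fun z => min (z - x μ).val (x μ - z).val ≤ r))).card :=
        Finset.card_le_card hsub
    _ = ∏ μ : Fin P.d, ((Finset.univ : Finset (ZMod (P.sitesPerDir j))).filter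
          (fun z => min (z - x μ).val (x μ - z).val ≤ r)).card := Fintype.card_piFinset _
    _ ≤ ∏ _μ : Fin P.d, (2 * (r + 1)) := Finset.prod_le_prod' fun μ _ => card_zmod_near_le (x μ) r
    _ = (2 * (r + 1)) ^ P.d := by simp

end Torus

end Summit.QuantumFields.Balaban3D.Proofs.TorusBalls
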